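import Summits.FinalStateConjecture.FinalStateConjecture.Theses.BondiDrainDispersal
import Literature.Geometry.Lorentzian.TameGenericityLocal

/-!
# Crux `GenericCensoredHolesSettle` — line `birth`: BIRTH SKELETON (BC3; skeleton registrar, 2026-08-17)

Crux item `stmt-FinalStateConjecture-17285`, decl (FIXED, concluded BY NAME in
`GenericCensoredHolesSettle_of` / `GenericCensoredHolesSettle_proof`):
`Summit.FinalStateConjecture.FinalStateConjecture.Theses.BondiDrainDispersal.GenericCensoredHolesSettle`
(route `route-FinalStateConjecture-BondiDrainDispersal`, crux rank 5) — the GENERIC BRANCH of the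
route: for every data manifold `X`, tame-Christodoulou-generically in the admissible class, an MGHD
exists and every MGHD has complete `𝓘⁺` and, IF it has an event horizon (ray-theoretic), admits an
honest sub-extremal final-state decomposition (`RaysStayInClosure`, `HasExhaustiveCharts`,
`IsFutureOriented`). (= weak cosmic censorship + the black-hole final state, tame-generically.)

## The cut — "censorship first, then the two escape mechanisms", typed over existing declarations

Write `P D` for the crux's property of an admissible datum `D` (MGHD exists ∧ every MGHD is
censored and settles if it has a horizon). An exceptional datum `D` (`¬ P D`) lies in exactly one
of two strata, and the physics that moves it into the good set differs:

* the VIOLATING stratum `V = {some MGHD of D has incomplete 𝓘⁺}` — left by the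
  blue-shift / trapped-surface-formation instability of naked singularities (Christodoulou 1999),
  after which the black holes so formed must be shown to settle;
* the THRESHOLD stratum `T = {every MGHD censored, but some MGHD with an event horizon admits no
  honest sub-extremal decomposition}` (exactly-extremal end states `|a| = M`, Aretakis-hairy
  horizons, hypothetical non-settling censored holes) — left by the generic third law /
  extremal-critical-collapse picture (Kehle–Unger) together with large-data Kerr stability off the
  threshold.

Tame Christodoulou genericity is not closed under `∧` (docstring of
`isTameChristodoulouGeneric_of_relative`, `TameGenericityDiagonal.lean`), so weak cosmic censorship
cannot be conjoined with a settling statement; it enters through its WITNESS CURVES. Hence four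
named stubs, each a classical statement in its own right:

* `stub_mghdExists` — MGHD EXISTENCE for admissible data (Choquet-Bruhat–Geroch 1969, Thm. 3;
  Sbierski 2016). KNOWN in print; in the tree it is the named fact
  `choquetBruhat_geroch_exists_mghd_cauchy` (unproved, XL), from which this stub follows by
  `choquetBruhat_geroch_exists_mghd_cauchy.forall_mem_admissibleVacuumData` (its statement is this
  stub verbatim; `AdmissibleMGHDExistence.lean`). Shared with the `MGHDExists` items of the sibling
  routes. [known; XL as a formalisation]
* `stub_weakCosmicCensorship` — TAME WEAK COSMIC CENSORSHIP: tame-generically in the admissible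
  class every MGHD has complete `𝓘⁺` (Christodoulou CQG 16 (1999) p. A24; Dafermos–Rodnianski
  arXiv:0811.0354 §2.6.2). Verbatim the registered stub `stub_tameCensorship` of
  `Cruxes/TameCensorshipCollarMargin/Lines/birth.lean` (route BartnikGapSettling) and implied by
  `IsTameChristodoulouGeneric.mono` by the ITEM `PhaseMixingCapture.WeakCosmicCensorshipTame`
  (which carries the extra conjunct `∃ 𝒟, 𝒟.IsMaximal`). [open-problem; XL]
* `stub_landing` — LANDING IN THE GOOD SET ALONG CENSORED CURVES, local in the parameter: given
  one end `e` and a tame, immersed, injective curve `F` of admissible data whose base datum `F 0`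
  has an MGHD with INCOMPLETE `𝓘⁺` and whose members off `0` are censored (this is what Stub 1
  hands over), there is a tame immersed injective admissible curve `F'` through the same base
  datum (on some end `e'`) and an `ε > 0` such that for `0 < ‖c‖ < ε` every MGHD of `F' c` is
  censored AND settles if it has a horizon. [open-problem; L–XL]
* `stub_thresholdEscape` — ESCAPE FROM THE CENSORED THRESHOLD, local in the parameter: through
  every admissible datum all of whose MGHDs are censored but one of which has an event horizon and
  NO honest sub-extremal decomposition passes a tame immersed injective admissible curve whose
  members with `0 < ‖c‖ < ε` are good. [open-problem; XL]

Composition `GenericCensoredHolesSettle_of` (kernel-checked, no `sorry` of its own, ~30 lines):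
locality of tame genericity in the parameter (`InitialDataSet.isTameChristodoulouGeneric_of_local`,
`TameGenericityLocal.lean`, landed) reduces the crux to producing a locally good curve through each
exceptional datum `D`; by excluded middle `D ∈ T` (then Stub 0 shows some MGHD has a horizon and
does not settle, and Stub 3 gives the curve) or `D ∈ V` (then Stub 1's genericity witness is a
censored curve through `D`, along which Stub 2 lands in the good set); Stub 0 upgrades "good" to
the crux's property (the anti-vacuity conjunct `∃ 𝒟, 𝒟.IsMaximal`) member by member. The seam is a
case analysis over the two strata plus the tree's locality theorem — not `exact ⟨h₁, h₂⟩`.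

Logical position: the crux implies Stubs 1–3 (weakenings; §4, sorry-free) and Stub 0 is the known
Choquet-Bruhat–Geroch theorem; Stubs 0–3 imply the crux (§3). No stub alone is the crux or the
summit: Stub 1 says nothing about black holes, Stub 2 produces nothing without a censoring curve,
Stub 3 never meets a censorship-violating datum, Stub 0 is MGHD existence.

## BC3 probes (seat folder `bc/GenericCensoredHolesSettle_probe_<k>{a,b}.lean`; they import the
## route file only — NOT this skeleton — so no sorried theorem concluding the crux is in scope)
For each stub `S` (signature restated verbatim as a `def`): `S → GenericCensoredHolesSettle` and
`S → FinalStateConjecture` by `first | exact? | simpa [S] | (unfold S; simpa) | aesop`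
(400 000 heartbeats): all eight FAIL (log in `Lines/birth.md`).

## Disproof used
None relevant: the crux has no `Disproof.lean` / `Negative/` lemma (`ledger crux ls
stmt-FinalStateConjecture-17285`: no workfiles before this one); `ledger negatives --problem
FinalStateConjecture` lists one unrelated refutation (`not_UniformPhotonSphereChannels`, a
Regge–Wheeler channel estimate). No stub is an instance of it. The stubs are typed over the T2
re-typed notions only (tame genericity on one fixed end — no burial witnesses; honest radii;
`RaysStayInClosure`; `IsFutureOriented`).
-/

noncomputable section

-- D-0017: single-problem summit, `Summit.<S>.<S>.…` by design (cf. lakefile `weak.linter.dupNamespace`).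
set_option linter.dupNamespace false

namespace Summit.FinalStateConjecture.FinalStateConjecture.Cruxes.GenericCensoredHolesSettle.Birth

open Set Filter Function Topology TopologicalSpace
open scoped Manifold ContDiff Classical
open Literature.Geometry.Lorentzian
open Summit.FinalStateConjecture.FinalStateConjecture.Theses.BondiDrainDispersal

/-! ## §0 Vocabulary (readability only: used in the named statements and the composition; NO stub
signature mentions it — the stubs are stated EXPANDED over Statement + Literature declarations) -/

section Vocabulary

variable {X : Type} [TopologicalSpace X] [ChartedSpace E3 X] [IsManifold (𝓡 3) ∞ X]
  [ConnectedSpace X]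

/-- **The MGHD `𝒟` has an event horizon**, ray-theoretic rendering (verbatim the antecedent of the
crux's horizon branch and the negated hypothesis of `CensoredHorizonlessDisperse`): some event `q`
lies outside the chronological past of every future-complete normalised null ray issued from the
data hypersurface. [cite: DafermosLuk2017, Conjecture 1] -/
abbrev HasHorizon {D : InitialDataSet (𝓡 3) X} (𝒟 : VacuumCauchyDevelopment D) : Prop :=
  ∀ [𝒟.metric.HasLeviCivita], ∃ q : 𝒟.carrier, ∀ (p : X) (γ : ℝ → 𝒟.carrier) (dom : Set ℝ),
    𝒟.metric.IsNormalisedNullRayFrom 𝒟.timeOrientation 𝒟.embed 𝒟.normal p γ dom →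
      ¬ BddAbove dom → q ∉ 𝒟.metric.chronologicalPast 𝒟.timeOrientation (γ '' (dom ∩ Set.Ici 0))

/-- **The MGHD `𝒟` settles down to finitely many sub-extremal Kerr black holes plus radiation**,
honestly (verbatim the consequent of the crux's horizon branch = the Statement's decomposition
conjunct): an exterior region `O` and a `C²` final-state decomposition `d` of it with every
`(Mᵢ, aᵢ)` sub-extremal, `O = J⁺(ιX) ∩ I⁻(charted)`, `RaysStayInClosure`, exhaustive charts with
honest radii, future-oriented chart time. [cite: DafermosLuk2017, Conjecture 1] -/
abbrev Settles {D : InitialDataSet (𝓡 3) X} (𝒟 : VacuumCauchyDevelopment D) : Prop :=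
  ∃ (O : Set 𝒟.carrier) (d : FinalStateDecomposition 𝒟.toSpacetime O 2),
    (∀ i, Kerr.IsSubextremal (d.mass i) (d.spin i)) ∧
      O = Summit.FinalStateConjecture.exteriorOf 𝒟.toCauchyDevelopment d.charted ∧
        Summit.FinalStateConjecture.RaysStayInClosure 𝒟.toCauchyDevelopment O ∧
          Summit.FinalStateConjecture.HasExhaustiveCharts d ∧
            Summit.FinalStateConjecture.IsFutureOriented d

/-- **`D` is censored**: every MGHD of `D` has complete future null infinity (sojourn form).
[cite: Christodoulou1999, pp. A26–A27] -/
abbrev IsCensored (D : InitialDataSet (𝓡 3) X) : Prop :=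
  ∀ 𝒟 : VacuumCauchyDevelopment D, 𝒟.IsMaximal →
    Summit.FinalStateConjecture.HasCompleteNullInfinity 𝒟.toCauchyDevelopment

/-- **`D` is good**: every MGHD of `D` is censored and settles if it has an event horizon — the
crux's property without its anti-vacuity conjunct `∃ 𝒟, 𝒟.IsMaximal`. [cite: DafermosLuk2017, Conjecture 1] -/
abbrev IsGood (D : InitialDataSet (𝓡 3) X) : Prop :=
  ∀ 𝒟 : VacuumCauchyDevelopment D, 𝒟.IsMaximal →
    Summit.FinalStateConjecture.HasCompleteNullInfinity 𝒟.toCauchyDevelopment ∧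
      (HasHorizon 𝒟 → Settles 𝒟)

end Vocabulary

/-! ## §1 The four statements of the line (named; nothing here is a route item) -/

/-- **MGHD EXISTENCE for admissible data** (`stub_mghdExists`): every datum of Christodoulou's
admissible class on every connected Hausdorff second-countable `3`-manifold has a maximal vacuum
Cauchy development (repaired structure `VacuumCauchyDevelopment`, `IsMaximal`). Choquet-Bruhat–Geroch,
CMP 14 (1969), Thm. 3 (p. 332); Sbierski, AHP 17 (2016) = arXiv:1309.7591, Thm. 2.8. KNOWN in print;
in the tree the unproved named fact `choquetBruhat_geroch_exists_mghd_cauchy`, whose corollary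
`….forall_mem_admissibleVacuumData` is this statement verbatim. Why it might fail (as a tree
statement): `IsMaximal` asks EVERY typed vacuum Cauchy development of `D` (carrier in `Type`) to
embed into one `𝒟`; a typing defect of the repaired prelude, not the mathematics, is the risk.
[cite: ChoquetBruhatGeroch1969CMP, Thm. 3 (p. 332)] -/
def AdmissibleMGHDExistence : Prop :=
  ∀ (X : Type) [TopologicalSpace X] [ChartedSpace E3 X] [IsManifold (𝓡 3) ∞ X] [T2Space X]
    [SecondCountableTopology X] [ConnectedSpace X],
    ∀ D ∈ admissibleVacuumData X, ∃ 𝒟 : VacuumCauchyDevelopment D, 𝒟.IsMaximal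

/-- **TAME WEAK COSMIC CENSORSHIP** (`stub_weakCosmicCensorship`): for every connected Hausdorff
second-countable `3`-manifold `X`, tame-generically in the admissible class (Christodoulou
codimension `1`; witness curves on ONE fixed asymptotically flat end, `wDist`-continuous and
immersed at `0`), every MGHD has complete future null infinity. Christodoulou, CQG 16 (1999) A23,
p. A24 (proved for the spherically symmetric scalar field, Ann. Math. 149 (1999) 183, p. 187); open
in vacuum without symmetry. Why it might fail: the exterior-naked-singularity vacuum solutions of
Rodnianski–Shlapentokh-Rothman (arXiv:1912.08478) might be stable under admissible perturbations at
FIXED asymptotics (tameness forbids censoring by a far-out giant hole); trapped-surface-formation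
instability is known only in symmetry / for the scalar field. [cite: Christodoulou1999, p. A24]
[cite: arXiv08110354, §2.6.2] -/
def TameWeakCosmicCensorship : Prop :=
  ∀ (X : Type) [TopologicalSpace X] [ChartedSpace E3 X] [IsManifold (𝓡 3) ∞ X] [T2Space X]
    [SecondCountableTopology X] [ConnectedSpace X],
    InitialDataSet.IsTameChristodoulouGeneric (admissibleVacuumData X) (fun D ↦ IsCensored D) 1

/-- **LANDING IN THE GOOD SET ALONG CENSORED CURVES, local in the parameter** (`stub_landing`): for
every end `e` and every tame (on `e`), immersed-at-`0`, injective curve `F` of admissible data whose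
base datum `F 0` has an MGHD with INCOMPLETE `𝓘⁺` and whose members off `0` are censored, there are
an end `e'`, a tame immersed injective curve `F'` of admissible data with `F' 0 = F 0`, and `ε > 0`
such that every member `F' c`, `0 < ‖c‖ < ε`, is GOOD (every MGHD censored, and settling to finitely
many sub-extremal Kerr black holes — honestly: `RaysStayInClosure`, exhaustive future-oriented
charts — whenever it has an event horizon). Content: the censoring escape from a naked-singularity
datum can be steered into the settling regime — black holes formed by trapped-surface-forming
perturbations of a censorship-violating datum are strictly sub-extremal and decay to Kerr (large-data
Kerr stability enters HERE, along one curve). Why it might fail: the censoring curves through a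
violating datum may be forced to run inside the threshold stratum (extremal or hairy holes forming
all along the escape), or settle only outside the honest-chart clauses; Kerr stability is known only
for `|a| ≪ M` (Klainerman–Szeftel) and no large-data capture theorem exists.
[cite: Christodoulou1999, p. A24] [cite: KlainermanSzeftel2023] [cite: KehleUnger2025] -/
def LandingAlongCensoredCurves : Prop :=
  ∀ (X : Type) [TopologicalSpace X] [ChartedSpace E3 X] [IsManifold (𝓡 3) ∞ X] [T2Space X]
    [SecondCountableTopology X] [ConnectedSpace X],
    ∀ (e : AFEnd X) (F : EuclideanSpace ℝ (Fin 1) → InitialDataSet (𝓡 3) X),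
      InitialDataSet.IsTameDataFamily e 1 F → InitialDataSet.IsImmersedAtZero 1 F → Injective F →
        (∀ c, F c ∈ admissibleVacuumData X) →
          (∃ 𝒟 : VacuumCauchyDevelopment (F 0), 𝒟.IsMaximal ∧
              ¬ Summit.FinalStateConjecture.HasCompleteNullInfinity 𝒟.toCauchyDevelopment) →
            (∀ c ≠ 0, IsCensored (F c)) →
              ∃ (e' : AFEnd X) (F' : EuclideanSpace ℝ (Fin 1) → InitialDataSet (𝓡 3) X),
                InitialDataSet.IsTameDataFamily e' 1 F' ∧ InitialDataSet.IsImmersedAtZero 1 F' ∧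
                  F' 0 = F 0 ∧ Injective F' ∧ (∀ c, F' c ∈ admissibleVacuumData X) ∧
                    ∃ ε > (0 : ℝ), ∀ c, c ≠ 0 → ‖c‖ < ε → IsGood (F' c)

/-- **ESCAPE FROM THE CENSORED THRESHOLD, local in the parameter** (`stub_thresholdEscape`): through
every admissible datum `D` all of whose MGHDs have complete `𝓘⁺` but one of which has an event
horizon (ray-theoretic) and NO honest sub-extremal final-state decomposition pass one end `e`, a tame
immersed injective curve `F` of admissible data with `F 0 = D`, and `ε > 0` such that every member
`F c`, `0 < ‖c‖ < ε`, is good. Content: the censored-but-not-settling data — exactly-extremal end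
states (`|a| = M`, where `C²`-convergence up to the horizon also fails by the Aretakis instability),
photon-shell / hairy remnants, hypothetical eternally non-Kerr censored holes — form a stratum of
positive TAME codimension inside the censored data: the generic third law of black-hole mechanics
(Kehle–Unger: extremal critical collapse is a codimension-one threshold) plus large-data Kerr
stability on the sub-extremal side, produced along ONE curve through the threshold datum. Why it
might fail: the extremal threshold of vacuum collapse need not be a tame hypersurface (one-sided or
Cantor accumulation of thresholds along every admissible curve through `D`), a non-settling censored
hole could be STABLE (an open set of non-Kerr end states kills the summit itself), or every escaping
curve could lose censorship. [cite: KehleUnger2025] [cite: DafermosLuk2017, Conjecture 1]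
[cite: DafermosHolzegelRodnianskiTaylor2021] -/
def ThresholdEscape : Prop :=
  ∀ (X : Type) [TopologicalSpace X] [ChartedSpace E3 X] [IsManifold (𝓡 3) ∞ X] [T2Space X]
    [SecondCountableTopology X] [ConnectedSpace X],
    ∀ D ∈ admissibleVacuumData X, IsCensored D →
      (∃ 𝒟 : VacuumCauchyDevelopment D, 𝒟.IsMaximal ∧ HasHorizon 𝒟 ∧ ¬ Settles 𝒟) →
        ∃ (e : AFEnd X) (F : EuclideanSpace ℝ (Fin 1) → InitialDataSet (𝓡 3) X),
          InitialDataSet.IsTameDataFamily e 1 F ∧ InitialDataSet.IsImmersedAtZero 1 F ∧ F 0 = D ∧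
            Injective F ∧ (∀ c, F c ∈ admissibleVacuumData X) ∧
              ∃ ε > (0 : ℝ), ∀ c, c ≠ 0 → ‖c‖ < ε → IsGood (F c)

/-! ### Statements of the registered stubs, under the stub names
The skeleton audit reads the hypotheses of `GenericCensoredHolesSettle_of` BY NAME: each head is a
declared stub. -/
namespace Goal

/-- Statement of `stub_mghdExists`. -/
abbrev stub_mghdExists : Prop := AdmissibleMGHDExistence
/-- Statement of `stub_weakCosmicCensorship`. -/
abbrev stub_weakCosmicCensorship : Prop := TameWeakCosmicCensorship
/-- Statement of `stub_landing`. -/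
abbrev stub_landing : Prop := LandingAlongCensoredCurves
/-- Statement of `stub_thresholdEscape`. -/
abbrev stub_thresholdEscape : Prop := ThresholdEscape

end Goal

/-! ## §2 Registered stubs (the four `sorry`s of the file), stated EXPANDED over existing declarations
(Statement + Literature prelude only, fully qualified; no vocabulary of this file occurs in a stub
signature, so each registered signature elaborates standalone in a Theorems file). -/

/-- **Stub 0** (known in print, XL as a formalisation): MGHD existence for admissible data — see
`AdmissibleMGHDExistence`. [cite: ChoquetBruhatGeroch1969CMP, Thm. 3 (p. 332)] -/
theorem stub_mghdExists :
    ∀ (X : Type) [TopologicalSpace X] [ChartedSpace Literature.Geometry.Lorentzian.E3 X] [IsManifold (𝓡 3) ((⊤ : ℕ∞) : WithTop ℕ∞) X] [T2Space X] [SecondCountableTopology X] [ConnectedSpace X], ∀ D ∈ Literature.Geometry.Lorentzian.admissibleVacuumData X, ∃ 𝒟 : Literature.Geometry.Lorentzian.VacuumCauchyDevelopment D, 𝒟.IsMaximal := by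
  sorry

/-- **Stub 1** (XL, open-problem): tame weak cosmic censorship — see `TameWeakCosmicCensorship`.
[cite: Christodoulou1999, p. A24] -/
theorem stub_weakCosmicCensorship :
    ∀ (X : Type) [TopologicalSpace X] [ChartedSpace Literature.Geometry.Lorentzian.E3 X] [IsManifold (𝓡 3) ((⊤ : ℕ∞) : WithTop ℕ∞) X] [T2Space X] [SecondCountableTopology X] [ConnectedSpace X], Literature.Geometry.Lorentzian.InitialDataSet.IsTameChristodoulouGeneric (Literature.Geometry.Lorentzian.admissibleVacuumData X) (fun D ↦ ∀ 𝒟 : Literature.Geometry.Lorentzian.VacuumCauchyDevelopment D, 𝒟.IsMaximal → Summit.FinalStateConjecture.HasCompleteNullInfinity 𝒟.toCauchyDevelopment) 1 := by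
  sorry

/-- **Stub 2** (L–XL, open-problem): landing in the good set along censored curves, local in the
parameter — see `LandingAlongCensoredCurves`. [cite: Christodoulou1999, p. A24] [cite: KlainermanSzeftel2023] -/
theorem stub_landing :
    ∀ (X : Type) [TopologicalSpace X] [ChartedSpace Literature.Geometry.Lorentzian.E3 X] [IsManifold (𝓡 3) ((⊤ : ℕ∞) : WithTop ℕ∞) X] [T2Space X] [SecondCountableTopology X] [ConnectedSpace X], ∀ (e : Literature.Geometry.Lorentzian.AFEnd X) (F : EuclideanSpace ℝ (Fin 1) → Literature.Geometry.Lorentzian.InitialDataSet (𝓡 3) X), Literature.Geometry.Lorentzian.InitialDataSet.IsTameDataFamily e 1 F → Literature.Geometry.Lorentzian.InitialDataSet.IsImmersedAtZero 1 F → Function.Injective F → (∀ c, F c ∈ Literature.Geometry.Lorentzian.admissibleVacuumData X) → (∃ 𝒟 : Literature.Geometry.Lorentzian.VacuumCauchyDevelopment (F 0), 𝒟.IsMaximal ∧ ¬ Summit.FinalStateConjecture.HasCompleteNullInfinity 𝒟.toCauchyDevelopment) → (∀ c ≠ 0, ∀ 𝒟 : Literature.Geometry.Lorentzian.VacuumCauchyDevelopment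 (F c), 𝒟.IsMaximal → Summit.FinalStateConjecture.HasCompleteNullInfinity 𝒟.toCauchyDevelopment) → ∃ (e' : Literature.Geometry.Lorentzian.AFEnd X) (F' : EuclideanSpace ℝ (Fin 1) → Literature.Geometry.Lorentzian.InitialDataSet (𝓡 3) X), Literature.Geometry.Lorentzian.InitialDataSet.IsTameDataFamily e' 1 F' ∧ Literature.Geometry.Lorentzian.InitialDataSet.IsImmersedAtZero 1 F' ∧ F' 0 = F 0 ∧ Function.Injective F' ∧ (∀ c, F' c ∈ Literature.Geometry.Lorentzian.admissibleVacuumData X) ∧ ∃ ε > (0 : ℝ), ∀ c, c ≠ 0 → ‖c‖ < ε → ∀ 𝒟 : Literature.Geometry.Lorentzian.VacuumCauchyDevelopment (F' c), 𝒟.IsMaximal → Summit.FinalStateConjecture.HasCompleteNullInfinity 𝒟.toCauchyDevelopment ∧ ((∀ [𝒟.metric.HasLeviCivita], ∃ q : 𝒟.carrier, ∀ (p : X) (γ : ℝ → 𝒟.carrier) (dom : Set ℝ), 𝒟.metric.IsNormalisedNullRayFrom 𝒟.timeOrientation 𝒟.embed 𝒟.normal p γ dom → ¬ BddAbove dom →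 q ∉ 𝒟.metric.chronologicalPast 𝒟.timeOrientation (γ '' (dom ∩ Set.Ici 0))) → ∃ (O : Set 𝒟.carrier) (d : Literature.Geometry.Lorentzian.FinalStateDecomposition 𝒟.toSpacetime O 2), (∀ i, Literature.Geometry.Lorentzian.Kerr.IsSubextremal (d.mass i) (d.spin i)) ∧ O = Summit.FinalStateConjecture.exteriorOf 𝒟.toCauchyDevelopment d.charted ∧ Summit.FinalStateConjecture.RaysStayInClosure 𝒟.toCauchyDevelopment O ∧ Summit.FinalStateConjecture.HasExhaustiveCharts d ∧ Summit.FinalStateConjecture.IsFutureOriented d) := by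
  sorry

/-- **Stub 3** (XL, open-problem): escape from the censored threshold, local in the parameter — see
`ThresholdEscape`. [cite: KehleUnger2025] [cite: DafermosLuk2017, Conjecture 1] -/
theorem stub_thresholdEscape :
    ∀ (X : Type) [TopologicalSpace X] [ChartedSpace Literature.Geometry.Lorentzian.E3 X] [IsManifold (𝓡 3) ((⊤ : ℕ∞) : WithTop ℕ∞) X] [T2Space X] [SecondCountableTopology X] [ConnectedSpace X], ∀ D ∈ Literature.Geometry.Lorentzian.admissibleVacuumData X, (∀ 𝒟 : Literature.Geometry.Lorentzian.VacuumCauchyDevelopment D, 𝒟.IsMaximal → Summit.FinalStateConjecture.HasCompleteNullInfinity 𝒟.toCauchyDevelopment) → (∃ 𝒟 : Literature.Geometry.Lorentzian.VacuumCauchyDevelopment D, 𝒟.IsMaximal ∧ (∀ [𝒟.metric.HasLeviCivita], ∃ q : 𝒟.carrier, ∀ (p : X) (γ : ℝ → 𝒟.carrier) (dom : Set ℝ), 𝒟.metric.IsNormalisedNullRayFrom 𝒟.timeOrientation 𝒟.embed 𝒟.normal p γ dom → ¬ BddAbove dom → q ∉ 𝒟.metric.chronologicalPast 𝒟.timeOrientation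 (γ '' (dom ∩ Set.Ici 0))) ∧ ¬ ∃ (O : Set 𝒟.carrier) (d : Literature.Geometry.Lorentzian.FinalStateDecomposition 𝒟.toSpacetime O 2), (∀ i, Literature.Geometry.Lorentzian.Kerr.IsSubextremal (d.mass i) (d.spin i)) ∧ O = Summit.FinalStateConjecture.exteriorOf 𝒟.toCauchyDevelopment d.charted ∧ Summit.FinalStateConjecture.RaysStayInClosure 𝒟.toCauchyDevelopment O ∧ Summit.FinalStateConjecture.HasExhaustiveCharts d ∧ Summit.FinalStateConjecture.IsFutureOriented d) → ∃ (e : Literature.Geometry.Lorentzian.AFEnd X) (F : EuclideanSpace ℝ (Fin 1) → Literature.Geometry.Lorentzian.InitialDataSet (𝓡 3) X), Literature.Geometry.Lorentzian.InitialDataSet.IsTameDataFamily e 1 F ∧ Literature.Geometry.Lorentzian.InitialDataSet.IsImmersedAtZero 1 F ∧ F 0 = D ∧ Function.Injective F ∧ (∀ c, F c ∈ Literature.Geometry.Lorentzian.admissibleVacuumData X) ∧ ∃ ε > (0 : ℝ), ∀ c, c ≠ 0 → ‖c‖ < ε → ∀ 𝒟 : Literature.Geometry.Lorentzian.VacuumCauchyDevelopment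 (F c), 𝒟.IsMaximal → Summit.FinalStateConjecture.HasCompleteNullInfinity 𝒟.toCauchyDevelopment ∧ ((∀ [𝒟.metric.HasLeviCivita], ∃ q : 𝒟.carrier, ∀ (p : X) (γ : ℝ → 𝒟.carrier) (dom : Set ℝ), 𝒟.metric.IsNormalisedNullRayFrom 𝒟.timeOrientation 𝒟.embed 𝒟.normal p γ dom → ¬ BddAbove dom → q ∉ 𝒟.metric.chronologicalPast 𝒟.timeOrientation (γ '' (dom ∩ Set.Ici 0))) → ∃ (O : Set 𝒟.carrier) (d : Literature.Geometry.Lorentzian.FinalStateDecomposition 𝒟.toSpacetime O 2), (∀ i, Literature.Geometry.Lorentzian.Kerr.IsSubextremal (d.mass i) (d.spin i)) ∧ O = Summit.FinalStateConjecture.exteriorOf 𝒟.toCauchyDevelopment d.charted ∧ Summit.FinalStateConjecture.RaysStayInClosure 𝒟.toCauchyDevelopment O ∧ Summit.FinalStateConjecture.HasExhaustiveCharts d ∧ Summit.FinalStateConjecture.IsFutureOriented d) := by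
  sorry

/-! ## §3 The composition (kernel-checked; no `sorry` of its own) -/

/-- **THE CRUX BY NAME from the four registered stubs.** Locality of tame genericity in the
parameter (`InitialDataSet.isTameChristodoulouGeneric_of_local`, landed) reduces the crux to a
locally good tame immersed injective admissible curve through each exceptional datum `D`; case
split on the stratum of `D`: censored (then, `D` being exceptional and possessing an MGHD by Stub 0,
some MGHD has a horizon and does not settle — Stub 3 gives the curve) or violating (Stub 1's
genericity witness is a censored curve through `D`; Stub 2 lands along it); Stub 0 upgrades the
members to the crux's property. [folklore] -/
theorem GenericCensoredHolesSettle_of :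
    Goal.stub_mghdExists → Goal.stub_weakCosmicCensorship → Goal.stub_landing →
      Goal.stub_thresholdEscape → GenericCensoredHolesSettle := by
  intro h₀ h₁ h₂ h₃ X _ _ _ _ _ _
  refine InitialDataSet.isTameChristodoulouGeneric_of_local fun D hD hbad ↦ ?_
  by_cases hC : IsCensored D
  · -- THRESHOLD stratum: `D` is censored; being exceptional and possessing an MGHD (Stub 0), one of
    -- its MGHDs has an event horizon and no honest sub-extremal decomposition
    have hT : ∃ 𝒟 : VacuumCauchyDevelopment D, 𝒟.IsMaximal ∧ HasHorizon 𝒟 ∧ ¬ Settles 𝒟 := by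
      by_contra hT
      refine hbad ⟨h₀ X D hD, fun 𝒟 h𝒟 ↦ ⟨hC 𝒟 h𝒟, fun hH ↦ ?_⟩⟩
      by_contra hS
      exact hT ⟨𝒟, h𝒟, hH, hS⟩
    -- Stub 3: a locally good tame immersed injective admissible curve through `D`
    obtain ⟨e, F, hF, himm, h0, hinj, hadm, ε, hε, hgood⟩ := h₃ X D hD hC hT
    -- Stub 0 upgrades "good" to the crux's property, member by member
    exact ⟨e, F, hF, himm, h0, hinj, hadm, ε, hε,
      fun c hc hcε ↦ ⟨h₀ X (F c) (hadm c), hgood c hc hcε⟩⟩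
  · -- VIOLATING stratum: Stub 1's genericity witness is a tame immersed injective admissible curve
    -- through `D` all of whose members off `0` are censored
    obtain ⟨e, F, hF, himm, h0, hinj, hadm, hE⟩ := h₁ X D ⟨hD, hC⟩
    have hcens : ∀ c ≠ 0, IsCensored (F c) := by
      intro c hc 𝒟 h𝒟
      by_contra hI
      exact hE c hc ⟨hadm c, fun h ↦ hI (h 𝒟 h𝒟)⟩
    subst h0
    -- the base datum has an MGHD with incomplete `𝓘⁺`
    have hV : ∃ 𝒟 : VacuumCauchyDevelopment (F 0), 𝒟.IsMaximal ∧
        ¬ Summit.FinalStateConjecture.HasCompleteNullInfinity 𝒟.toCauchyDevelopment := by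
      by_contra hV
      apply hC
      intro 𝒟 h𝒟
      by_contra hI
      exact hV ⟨𝒟, h𝒟, hI⟩
    -- Stub 2: land in the good set along the censored curve, through the same base datum
    obtain ⟨e', F', hF', himm', h0', hinj', hadm', ε, hε, hgood⟩ :=
      h₂ X e F hF himm hinj hadm hV hcens
    exact ⟨e', F', hF', himm', h0', hinj', hadm', ε, hε,
      fun c hc hcε ↦ ⟨h₀ X (F' c) (hadm' c), hgood c hc hcε⟩⟩

/-! ### Consistency: each registered stub, stated EXPANDED, IS the named statement of §1 (by `δ`). -/

theorem admissibleMGHDExistence_holds : AdmissibleMGHDExistence := stub_mghdExists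
theorem tameWeakCosmicCensorship_holds : TameWeakCosmicCensorship := stub_weakCosmicCensorship
theorem landingAlongCensoredCurves_holds : LandingAlongCensoredCurves := stub_landing
theorem thresholdEscape_holds : ThresholdEscape := stub_thresholdEscape

/-- **The crux from the skeleton** (closed modulo the four `sorry`s). [folklore] -/
theorem GenericCensoredHolesSettle_proof : GenericCensoredHolesSettle :=
  GenericCensoredHolesSettle_of stub_mghdExists stub_weakCosmicCensorship stub_landing
    stub_thresholdEscape

/-! ## §4 Sanity (no `sorry`): the crux implies Stubs 1–3 — they are genuine WEAKENINGS of the crux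
(Stub 0 is the Choquet-Bruhat–Geroch theorem), so no stub alone is the crux. -/

/-- The crux implies Stub 1 (forget the holes: `IsTameChristodoulouGeneric.mono`). [folklore] -/
theorem tameWeakCosmicCensorship_of_crux (h : GenericCensoredHolesSettle) :
    TameWeakCosmicCensorship := by
  intro X _ _ _ _ _ _
  exact (h X).mono fun D _ hP 𝒟 h𝒟 ↦ (hP.2 𝒟 h𝒟).1

/-- The crux implies Stub 2 (a violating base datum is exceptional; ignore the given curve; `ε = 1`).
[folklore] -/
theorem landingAlongCensoredCurves_of_crux (h : GenericCensoredHolesSettle) :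
    LandingAlongCensoredCurves := by
  intro X _ _ _ _ _ _ e F _ _ _ hadm hV _
  obtain ⟨𝒟₀, h𝒟₀, hI⟩ := hV
  obtain ⟨e', F', hF', himm', h0', hinj', hadm', hgood⟩ :=
    h X (F 0) ⟨hadm 0, fun hP ↦ hI (hP.2 𝒟₀ h𝒟₀).1⟩
  refine ⟨e', F', hF', himm', h0', hinj', hadm', 1, one_pos, fun c hc _ 𝒟 h𝒟 ↦ ?_⟩
  have hP : (∃ 𝒟 : VacuumCauchyDevelopment (F' c), 𝒟.IsMaximal) ∧ IsGood (F' c) := by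
    by_contra hP
    exact hgood c hc ⟨hadm' c, hP⟩
  exact hP.2 𝒟 h𝒟

/-- The crux implies Stub 3 (a censored datum with a non-settling horizon is exceptional; `ε = 1`).
[folklore] -/
theorem thresholdEscape_of_crux (h : GenericCensoredHolesSettle) : ThresholdEscape := by
  intro X _ _ _ _ _ _ D hD _ hT
  obtain ⟨𝒟₀, h𝒟₀, hH, hS⟩ := hT
  obtain ⟨e, F, hF, himm, h0, hinj, hadm, hgood⟩ :=
    h X D ⟨hD, fun hP ↦ hS ((hP.2 𝒟₀ h𝒟₀).2 hH)⟩
  refine ⟨e, F, hF, himm, h0, hinj, hadm, 1, one_pos, fun c hc _ 𝒟 h𝒟 ↦ ?_⟩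
  have hP : (∃ 𝒟 : VacuumCauchyDevelopment (F c), 𝒟.IsMaximal) ∧ IsGood (F c) := by
    by_contra hP
    exact hgood c hc ⟨hadm c, hP⟩
  exact hP.2 𝒟 h𝒟

end Summit.FinalStateConjecture.FinalStateConjecture.Cruxes.GenericCensoredHolesSettle.Birth

end
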